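import Literature.Analysis.FluidPDE.FractionalNSPrescribedEnergyIteration
import Literature.Analysis.FluidPDE.FractionalNSPrescribedEnergyFamiliesParameters
import HarnessLib

/-!
# The parameter sums (43) of Colombo–De Lellis–De Rosa 2018 and the integer frequencies (34)

Analysis/FluidPDE proofs-only file (no definitions). Elementary real-variable bookkeeping for the
amplitudes `δ_q = a^{-b^q}` (`CDLDR.amp`) and integer frequencies
`λ_q ∈ ℕ ∩ [a^{cb^{q+1}}, 2a^{cb^{q+1}}]` (34) of the convex-integration scheme of Colombo–De Lellis–
De Rosa, *Ill-posedness of Leray solutions for the hypodissipative Navier–Stokes equations*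
(2018), §3–§4: the source states (§4 (43)) "the choice of the sequences `{δ_q}` and `{λ_q}` …
implies that, for `a > a₀(b,c)`, we have `∑_{j≤q} δ_jλ_j ≤ 2δ_qλ_q`,
`1 ≤ ∑_{j≤q} δ_j^{1/2}λ_j ≤ 2δ_q^{1/2}λ_q`, `∑_j δ_j ≤ ∑_j δ_j^{1/2} ≤ 2`", which is what turns the
increment bounds (27)–(30) into the working hypotheses (44)–(46) of the inductive step. We prove
these with the explicit threshold `a ≥ 9^{1/(b-1)}` (i.e. `a^{(b-1)/2} ≥ 3`, which makes
consecutive terms of the super-geometric sequences `a^{±κb^j}`, `κ ≥ 1/2`, differ by a factor at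
least `3`):

* `CDLDR.sum_rpow_pow_le_half`, `CDLDR.sum_rpow_neg_pow_succ_le_half` — the two abstract
  super-geometric sums; `CDLDR.three_le_rpow_of_le` — the threshold;
* `CDLDR.sum_sqrt_amp_succ_le` — `∑_{j=1}^{q} δ_j^{1/2} ≤ ½`;
* `CDLDR.sum_sqrt_amp_mul_le` — `∑_{j≤q} δ_j^{1/2}λ_j ≤ 2δ_q^{1/2}λ_q` (needs `cb ≥ 1`);
* `CDLDR.sum_amp_mul_le` — `∑_{j≤q} δ_jλ_j ≤ 2δ_qλ_q` (needs `cb ≥ 3/2`);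
* `CDLDR.exists_freq` — the integer frequencies `λ_q = ⌈a^{cb^{q+1}}⌉` satisfy (34) for `a ≥ 1`.

Used by `FractionalNSPrescribedEnergyIterationAssembly.lean` (Prop. 3.2 from Lemma 3.1 and the
inductive step).

## References

* M. Colombo, C. De Lellis, L. De Rosa, Comm. Math. Phys. 362 (2018) (held: arXiv:1708.05666),
  §3 (34), §4 (43). [`ColomboDelellisDerosa2018`]
-/

noncomputable section

open Set

namespace Literature.Analysis.FluidPDE

namespace CDLDR

/-! ## The parameter sums (43) -/

/-- Super-geometric growth: if `a ≥ 1`, `κ ≥ 0`, `b ≥ 1` and `a^{κ(b-1)} ≥ 3`, then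
`∑_{j<q} a^{κb^j} ≤ ½ a^{κb^q}` (each term is at least three times the previous one).
[cite: ColomboDelellisDerosa2018, §4 (43)] -/
theorem sum_rpow_pow_le_half {a κ b : ℝ} (ha : 1 ≤ a) (hκ : 0 ≤ κ) (hb : 1 ≤ b)
    (h3 : 3 ≤ a ^ (κ * (b - 1))) (q : ℕ) :
    ∑ j ∈ Finset.range q, a ^ (κ * b ^ j) ≤ 1 / 2 * a ^ (κ * b ^ q) := by
  have ha0 : 0 ≤ a := by linarith
  induction q with
  | zero =>
    simp only [Finset.range_zero, Finset.sum_empty]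
    positivity
  | succ q ih =>
    rw [Finset.sum_range_succ]
    have hgrow : 3 * a ^ (κ * b ^ q) ≤ a ^ (κ * b ^ (q + 1)) := by
      have h1 : a ^ (κ * b ^ (q + 1)) = a ^ (κ * b ^ q) * a ^ (κ * b ^ q * (b - 1)) := by
        rw [← Real.rpow_add (by linarith)]
        congr 1; ring
      have h2 : a ^ (κ * (b - 1)) ≤ a ^ (κ * b ^ q * (b - 1)) := by
        apply Real.rpow_le_rpow_of_exponent_le ha
        have hbq : 1 ≤ b ^ q := one_le_pow₀ hb
        have hb1 : 0 ≤ b - 1 := by linarith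
        nlinarith [mul_nonneg hκ hb1]
      rw [h1]
      have h0 : 0 ≤ a ^ (κ * b ^ q) := Real.rpow_nonneg ha0 _
      calc 3 * a ^ (κ * b ^ q) = a ^ (κ * b ^ q) * 3 := by ring
        _ ≤ a ^ (κ * b ^ q) * a ^ (κ * b ^ q * (b - 1)) :=
            mul_le_mul_of_nonneg_left (h3.trans h2) h0
    linarith

/-- Super-geometric decay: if `a ≥ 1`, `b ≥ 1` and `a^{(b-1)/2} ≥ 3`, then
`∑_{j<q} a^{-b^{j+1}/2} ≤ ½`, i.e. `∑_{j=1}^{q} δ_j^{1/2} ≤ ½` (each term is at most a third of the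
previous one and the first is at most `1/3`). [cite: ColomboDelellisDerosa2018, §4 (43)] -/
theorem sum_rpow_neg_pow_succ_le_half {a b : ℝ} (ha : 1 ≤ a) (hb : 1 ≤ b)
    (h3 : 3 ≤ a ^ ((b - 1) / 2)) (q : ℕ) :
    ∑ j ∈ Finset.range q, a ^ (-(1 / 2 * b ^ (j + 1))) ≤ 1 / 2 := by
  have ha0 : 0 < a := by linarith
  set x : ℕ → ℝ := fun j => a ^ (-(1 / 2 * b ^ (j + 1))) with hx
  have hx0 : ∀ j, 0 ≤ x j := fun j => Real.rpow_nonneg ha0.le _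
  have hdec : ∀ j, 3 * x (j + 1) ≤ x j := by
    intro j
    have h1 : x j = x (j + 1) * a ^ (1 / 2 * b ^ (j + 1) * (b - 1)) := by
      simp only [hx]
      rw [← Real.rpow_add ha0]
      congr 1; ring
    have h2 : a ^ ((b - 1) / 2) ≤ a ^ (1 / 2 * b ^ (j + 1) * (b - 1)) := by
      apply Real.rpow_le_rpow_of_exponent_le ha
      have hbq : 1 ≤ b ^ (j + 1) := one_le_pow₀ hb
      have hb1 : 0 ≤ b - 1 := by linarith
      nlinarith
    rw [h1]
    calc 3 * x (j + 1) = x (j + 1) * 3 := by ring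
      _ ≤ x (j + 1) * a ^ (1 / 2 * b ^ (j + 1) * (b - 1)) :=
          mul_le_mul_of_nonneg_left (h3.trans h2) (hx0 _)
  have hfirst : 3 * x 0 ≤ 1 := by
    have h2 : a ^ ((b - 1) / 2) ≤ a ^ (1 / 2 * b ^ (0 + 1)) := by
      apply Real.rpow_le_rpow_of_exponent_le ha
      rw [zero_add, pow_one]; linarith
    have h4 : x 0 * a ^ (1 / 2 * b ^ (0 + 1)) = 1 := by
      simp only [hx]
      rw [← Real.rpow_add ha0, neg_add_cancel, Real.rpow_zero]
    have h5 := h3.trans h2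
    calc 3 * x 0 ≤ a ^ (1 / 2 * b ^ (0 + 1)) * x 0 := by nlinarith [hx0 0]
      _ = 1 := by rw [mul_comm]; exact h4
  have key : ∀ n, ∑ j ∈ Finset.range n, x j + 3 / 2 * x n ≤ 3 / 2 * x 0 := by
    intro n
    induction n with
    | zero => simp
    | succ n ih =>
      rw [Finset.sum_range_succ]
      have := hdec n
      linarith
  have h1 := key q
  have h2 := hx0 q
  show ∑ j ∈ Finset.range q, x j ≤ 1 / 2
  linarith

/-- The threshold of the bookkeeping: for `b > 1`, `κ ≥ 1/2` and `a ≥ 9^{1/(b-1)}` one has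
`a^{κ(b-1)} ≥ 3`. [folklore] -/
theorem three_le_rpow_of_le {a b κ : ℝ} (hb : 1 < b) (hκ : 1 / 2 ≤ κ)
    (ha : (9 : ℝ) ^ (1 / (b - 1)) ≤ a) : 3 ≤ a ^ (κ * (b - 1)) := by
  have h9 : (0 : ℝ) ≤ 9 := by norm_num
  have hb1 : 0 < b - 1 := by linarith
  have h90 : 0 ≤ (9 : ℝ) ^ (1 / (b - 1)) := Real.rpow_nonneg h9 _
  have h91 : 1 ≤ (9 : ℝ) ^ (1 / (b - 1)) := Real.one_le_rpow (by norm_num) (by positivity)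
  have ha1 : 1 ≤ a := h91.trans ha
  have h93 : ((9 : ℝ) ^ (1 / (b - 1))) ^ ((b - 1) / 2) = 3 := by
    rw [← Real.rpow_mul h9]
    have : 1 / (b - 1) * ((b - 1) / 2) = 1 / 2 := by field_simp
    rw [this, show (9 : ℝ) = 3 ^ 2 by norm_num, ← Real.sqrt_eq_rpow, Real.sqrt_sq (by norm_num)]
  calc (3 : ℝ) = ((9 : ℝ) ^ (1 / (b - 1))) ^ ((b - 1) / 2) := h93.symm
    _ ≤ a ^ ((b - 1) / 2) := Real.rpow_le_rpow h90 ha (by linarith)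
    _ ≤ a ^ (κ * (b - 1)) := by
        apply Real.rpow_le_rpow_of_exponent_le ha1
        nlinarith [mul_nonneg (sub_nonneg.2 hκ) hb1.le]

/-- (43), amplitudes: `∑_{j=1}^{q} δ_j^{1/2} ≤ ½` for `a ≥ 9^{1/(b-1)}`, `b > 1`.
[cite: ColomboDelellisDerosa2018, §4 (43)] -/
theorem sum_sqrt_amp_succ_le {a b : ℝ} (hb : 1 < b) (ha : (9 : ℝ) ^ (1 / (b - 1)) ≤ a) (q : ℕ) :
    ∑ j ∈ Finset.range q, Real.sqrt (amp a b (j + 1)) ≤ 1 / 2 := by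
  have h91 : 1 ≤ (9 : ℝ) ^ (1 / (b - 1)) := Real.one_le_rpow (by norm_num) (by
    have : 0 < b - 1 := by linarith
    positivity)
  have ha1 : 1 ≤ a := h91.trans ha
  have ha0 : 0 < a := by linarith
  have h3 : 3 ≤ a ^ ((b - 1) / 2) := by
    have := three_le_rpow_of_le hb (le_refl (1 / 2 : ℝ)) ha
    rwa [show 1 / 2 * (b - 1) = (b - 1) / 2 by ring] at this
  calc ∑ j ∈ Finset.range q, Real.sqrt (amp a b (j + 1))
      = ∑ j ∈ Finset.range q, a ^ (-(1 / 2 * b ^ (j + 1))) :=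
        Finset.sum_congr rfl fun j _ => by rw [amp_def, sqrt_rpow_neg_pow ha0]
    _ ≤ 1 / 2 := sum_rpow_neg_pow_succ_le_half ha1 hb.le h3 q

/-- (43), first spatial derivatives: `∑_{j≤q} δ_j^{1/2}λ_j ≤ 2δ_q^{1/2}λ_q` for integer
frequencies `λ_j ∈ [a^{cb^{j+1}}, 2a^{cb^{j+1}}]`, `cb > 1/2`, `a ≥ 9^{1/(b-1)}` (and `cb - 1/2 ≥ 1/2`).
[cite: ColomboDelellisDerosa2018, §4 (43)] -/
theorem sum_sqrt_amp_mul_le {a b c : ℝ} {Λ : ℕ → ℕ} (hb : 1 < b) (hcb : 1 ≤ c * b)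
    (ha : (9 : ℝ) ^ (1 / (b - 1)) ≤ a)
    (hΛ : ∀ q, a ^ (c * b ^ (q + 1)) ≤ Λ q ∧ (Λ q : ℝ) ≤ 2 * a ^ (c * b ^ (q + 1))) (q : ℕ) :
    ∑ j ∈ Finset.range (q + 1), Real.sqrt (amp a b j) * Λ j ≤
      2 * (Real.sqrt (amp a b q) * Λ q) := by
  have h91 : 1 ≤ (9 : ℝ) ^ (1 / (b - 1)) := Real.one_le_rpow (by norm_num) (by
    have : 0 < b - 1 := by linarith
    positivity)
  have ha1 : 1 ≤ a := h91.trans ha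
  have ha0 : 0 < a := by linarith
  set κ : ℝ := c * b - 1 / 2 with hκ
  have hκ2 : 1 / 2 ≤ κ := by rw [hκ]; linarith
  have h3 : 3 ≤ a ^ (κ * (b - 1)) := three_le_rpow_of_le hb hκ2 ha
  have hexp : ∀ j : ℕ, a ^ (-(1 / 2 * b ^ j)) * a ^ (c * b ^ (j + 1)) = a ^ (κ * b ^ j) := by
    intro j
    rw [← Real.rpow_add ha0]
    congr 1
    rw [hκ, pow_succ]; ring
  have hup : ∀ j, Real.sqrt (amp a b j) * Λ j ≤ 2 * a ^ (κ * b ^ j) := by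
    intro j
    rw [amp_def, sqrt_rpow_neg_pow ha0]
    calc a ^ (-(1 / 2 * b ^ j)) * (Λ j : ℝ)
        ≤ a ^ (-(1 / 2 * b ^ j)) * (2 * a ^ (c * b ^ (j + 1))) :=
          mul_le_mul_of_nonneg_left (hΛ j).2 (Real.rpow_nonneg ha0.le _)
      _ = 2 * a ^ (κ * b ^ j) := by rw [← hexp j]; ring
  have hlow : ∀ j, a ^ (κ * b ^ j) ≤ Real.sqrt (amp a b j) * Λ j := by
    intro j
    rw [amp_def, sqrt_rpow_neg_pow ha0, ← hexp j]
    exact mul_le_mul_of_nonneg_left (hΛ j).1 (Real.rpow_nonneg ha0.le _)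
  have hs := sum_rpow_pow_le_half ha1 (by linarith) hb.le h3 q
  rw [Finset.sum_range_succ]
  calc ∑ j ∈ Finset.range q, Real.sqrt (amp a b j) * Λ j + Real.sqrt (amp a b q) * Λ q
      ≤ ∑ j ∈ Finset.range q, 2 * a ^ (κ * b ^ j) + Real.sqrt (amp a b q) * Λ q :=
        add_le_add (Finset.sum_le_sum fun j _ => hup j) le_rfl
    _ = 2 * ∑ j ∈ Finset.range q, a ^ (κ * b ^ j) + Real.sqrt (amp a b q) * Λ q := by
        rw [Finset.mul_sum]
    _ ≤ 2 * (1 / 2 * a ^ (κ * b ^ q)) + Real.sqrt (amp a b q) * Λ q := by linarith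
    _ = a ^ (κ * b ^ q) + Real.sqrt (amp a b q) * Λ q := by ring
    _ ≤ 2 * (Real.sqrt (amp a b q) * Λ q) := by linarith [hlow q]

/-- (43), pressure increments: `∑_{j≤q} δ_jλ_j ≤ 2δ_qλ_q` for integer frequencies
`λ_j ∈ [a^{cb^{j+1}}, 2a^{cb^{j+1}}]`, `cb ≥ 3/2`, `a ≥ 9^{1/(b-1)}`.
[cite: ColomboDelellisDerosa2018, §4 (43)] -/
theorem sum_amp_mul_le {a b c : ℝ} {Λ : ℕ → ℕ} (hb : 1 < b) (hcb : 3 / 2 ≤ c * b)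
    (ha : (9 : ℝ) ^ (1 / (b - 1)) ≤ a)
    (hΛ : ∀ q, a ^ (c * b ^ (q + 1)) ≤ Λ q ∧ (Λ q : ℝ) ≤ 2 * a ^ (c * b ^ (q + 1))) (q : ℕ) :
    ∑ j ∈ Finset.range (q + 1), amp a b j * Λ j ≤ 2 * (amp a b q * Λ q) := by
  have h91 : 1 ≤ (9 : ℝ) ^ (1 / (b - 1)) := Real.one_le_rpow (by norm_num) (by
    have : 0 < b - 1 := by linarith
    positivity)
  have ha1 : 1 ≤ a := h91.trans ha
  have ha0 : 0 < a := by linarith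
  set κ : ℝ := c * b - 1 with hκ
  have hκ2 : 1 / 2 ≤ κ := by rw [hκ]; linarith
  have h3 : 3 ≤ a ^ (κ * (b - 1)) := three_le_rpow_of_le hb hκ2 ha
  have hexp : ∀ j : ℕ, a ^ (-(b ^ j)) * a ^ (c * b ^ (j + 1)) = a ^ (κ * b ^ j) := by
    intro j
    rw [← Real.rpow_add ha0]
    congr 1
    rw [hκ, pow_succ]; ring
  have hup : ∀ j, amp a b j * Λ j ≤ 2 * a ^ (κ * b ^ j) := by
    intro j
    rw [amp_def]
    calc a ^ (-(b ^ j)) * (Λ j : ℝ) ≤ a ^ (-(b ^ j)) * (2 * a ^ (c * b ^ (j + 1))) :=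
          mul_le_mul_of_nonneg_left (hΛ j).2 (Real.rpow_nonneg ha0.le _)
      _ = 2 * a ^ (κ * b ^ j) := by rw [← hexp j]; ring
  have hlow : ∀ j, a ^ (κ * b ^ j) ≤ amp a b j * Λ j := by
    intro j
    rw [amp_def, ← hexp j]
    exact mul_le_mul_of_nonneg_left (hΛ j).1 (Real.rpow_nonneg ha0.le _)
  have hs := sum_rpow_pow_le_half ha1 (by linarith) hb.le h3 q
  rw [Finset.sum_range_succ]
  calc ∑ j ∈ Finset.range q, amp a b j * Λ j + amp a b q * Λ q
      ≤ ∑ j ∈ Finset.range q, 2 * a ^ (κ * b ^ j) + amp a b q * Λ q :=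
        add_le_add (Finset.sum_le_sum fun j _ => hup j) le_rfl
    _ = 2 * ∑ j ∈ Finset.range q, a ^ (κ * b ^ j) + amp a b q * Λ q := by
        rw [Finset.mul_sum]
    _ ≤ 2 * (1 / 2 * a ^ (κ * b ^ q)) + amp a b q * Λ q := by linarith
    _ = a ^ (κ * b ^ q) + amp a b q * Λ q := by ring
    _ ≤ 2 * (amp a b q * Λ q) := by linarith [hlow q]

/-- The integer frequencies (34): `λ_q = ⌈a^{cb^{q+1}}⌉ ∈ [a^{cb^{q+1}}, 2a^{cb^{q+1}}]` for
`a ≥ 1`, `b, c ≥ 0`. [cite: ColomboDelellisDerosa2018, §3 (34)] -/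
theorem exists_freq {a b c : ℝ} (ha : 1 ≤ a) (hb : 0 ≤ b) (hc : 0 ≤ c) :
    ∃ Λ : ℕ → ℕ, ∀ q, a ^ (c * b ^ (q + 1)) ≤ Λ q ∧ (Λ q : ℝ) ≤ 2 * a ^ (c * b ^ (q + 1)) := by
  refine ⟨fun q => ⌈a ^ (c * b ^ (q + 1))⌉₊, fun q => ⟨Nat.le_ceil _, ?_⟩⟩
  have h1 : 1 ≤ a ^ (c * b ^ (q + 1)) := Real.one_le_rpow ha (by positivity)
  have h2 := Nat.ceil_lt_add_one (zero_le_one.trans h1)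
  show (⌈a ^ (c * b ^ (q + 1))⌉₊ : ℝ) ≤ 2 * a ^ (c * b ^ (q + 1))
  linarith

end CDLDR

end Literature.Analysis.FluidPDE
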